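/-
Copyright: the b2b-balaban T⁴-continuum CRUX team, row NE7b OWNER lineage `t4-ne7b-p1` (gen 130). Project licence.
-/
import Summits.QuantumFields.BalabanUV.T4Continuum.Spine.NE7b.SupEffectiveActionDerivative

/-!
# THE STEP'S EFFECTIVE ACTION IS TWICE DIFFERENTIABLE IN THE EXTERNAL FIELD: for `C²` remainders `w_x` (`|w_x'(t)| ≤ κ₁|t|`, `|w_x''(t)| ≤ κ₂`,
# stability `w_x(t) ≥ −κ₀t²`) over a Gaussian scale `N(0,Γ)` with the regulator margin `(2κ₀(1+τ)+4δ)γ_op ≤ θ < 1`, at EVERY `ψ₀` the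
# gradient map `ψ ↦ D_ψ(−log Z)(ψ)` of (313) is Fréchet differentiable, with derivative (the HESSIAN of the next potential)
#   `Z⁻¹ • ∫e^{−V(ψ₀,ω)}•(D₂(ψ₀,ω) − D(ψ₀,ω)⊗D(ψ₀,ω))dN(0,Γ) + (Z⁻²•G)⊗G`,  `G = ∫e^{−V}•D`, `D₂ = Σ w_x''•proj_x⊗proj_x`
# — a second dominated differentiation of the tilted numerator and the quotient rule; applied to two directions it is the covariance
# formula `⟨D₂hk⟩_ν − Cov_ν(Dh,Dk)` (read in the successor file) (row NE7b, node U5c; (313) BY NAME + Mathlib's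
# `hasFDerivAt_integral_of_dominated_of_fderiv_le`; [folklore])

Cell `pub-balaban`, sub-cell `t4`, spine estimate NE7b (`T4WeightBudget.RelWeightBound`; the cell's OWN estimate — NOT PRINTED in
[Bałaban 1983–89], NOT PROVED).  Crux-route work under `Spine/NE7b/` by the row OWNER (`t4-ne7b-p1` gen 130, file (319)) under FREEZE
(0)'s crux-prover clause, on § [NE7bP1-G129-HANDOFF] NEXT (i) (the Hessian of the next potential `−log Z_ψ`); NOTHING of Bałaban's is
named as a Lean object, valued or asserted; no `T4Continuum/Support` leaf typed; no `def`, no notation; zero `sorry`.  Imports (BY NAME):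
the OWNER's (313) `…SupEffectiveActionDerivative` (`hasFDerivAt_cellSum`, `norm_cellDeriv_le`, `sum_sq_ball_le`, `aestronglyMeasurable_cellDeriv`,
`cellDeriv_apply`, `integrable_domination`, `hasFDerivAt_step`, `hasFDerivAt_neg_log_step`, `integrable_weighted_cellDeriv`,
`mul_opBound_le_of_le`) and through it (306) (`measurable_cellSum`, `cellSum_eq_sum_biUnion`), (297) (`neg_sum_le_of_stable`,
`integrable_exp_neg`); Mathlib's `HasFDerivAt.smul`, `HasFDerivAt.smul_const`, `HasDerivAt.comp_hasFDerivAt`, `hasDerivAt_inv`,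
`ContinuousLinearMap.smulRight`, `ContinuousLinearMap.norm_smulRight_apply`, `isBoundedBilinearMap_smulRight`,
`hasFDerivAt_integral_of_dominated_of_fderiv_le`, `Real.quadratic_le_exp_of_nonneg`.

WHY (located).  (313) gave the gradient of `−log Z_ψ` as a tilted mean, (316)∕(318) the two second-order LETTERS of `−log Z_ψ` without
differentiating twice.  To extract the next Hessian (the quadratic form the iteration hands to the next Gaussian step) and to read the
letters as bounds on it, the road needs `−log Z_ψ ∈ C²` with the Hessian in closed form: differentiating the tilted numerator
`G(ψ) = ∫e^{−V(ψ,ω)}•D(ψ,ω)dμ` once more under the integral sign (product rule `d_ψ(e^{−V}•D) = e^{−V}•(D₂ − D⊗D)`, dominated on the unit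
ball about `ψ₀` by ONE Gaussian-integrable function — stability, `|w'| ≤ κ₁|t|`, `|w''| ≤ κ₂`, and `S² ≤ e^{2δS}∕(2δ²)`), and the quotient
rule for `Z⁻¹•G`.

WHAT IS PROVED ([folklore]; `μ = N(0,Γ)` on `ι → ℝ`, `Γ ⪰ 0`, `Γ ⪯ γ_op·1`; cells pairwise disjoint; `w_x ∈ C²` with `w'_x, w''_x` measurable,
`|w'_x(t)| ≤ κ₁|t|`, `|w''_x(t)| ≤ κ₂`, `−κ₀t² ≤ w_x(t)`; `V(ψ,ω) = Σ_{p∈C}Σ_{x∈cell p}w_x(ω_x+ψ_x)`, `D(ψ,ω) = Σ w'_x(ω_x+ψ_x)•proj_x`,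
`D₂(ψ,ω) = Σ w''_x(ω_x+ψ_x)•(proj_x⊗proj_x)` (`a⊗b = a.smulRight b`), `Z(ψ) = ∫e^{−V(ψ,ω)}dμ`, `G(ψ) = ∫e^{−V(ψ,ω)}•D(ψ,ω)dμ`):
* §1 calculus ∕ size: `hasFDerivAt_cellDeriv` (`D_ψD = D₂`), `cellHess_apply` (`D₂hk = Σw''h_xk_x`), `smulRight_cellDeriv_apply`
  (`(D⊗D)hk = (Dh)(Dk)`), `norm_cellHess_le` (`‖D₂‖ ≤ κ₂#Y`), `aestronglyMeasurable_cellHess`, **`hasFDerivAt_weightedCellDeriv`**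
  (`d_ψ(e^{−V}•D) = e^{−V}•(D₂ − D⊗D)` at every `ψ, ω`), `eight_sq_le` (`8S² ≤ 4δ⁻²e^{2δS}`);
* §2 THE SECOND DOMINATION **`second_domination`**: on `closedBall ψ₀ 1`,
  `‖e^{−V}•(D₂ − D⊗D)‖ ≤ e^{κ₀(1+τ⁻¹)M}(κ₂#Y + κ₁²(2(#Y+2M)² + 4δ⁻²))·e^{½(2κ₀(1+τ)+4δ)Σ_Yω²}`, `M = 2Σ_Yψ₀² + 2`;
* §3 THE END: **`hasFDerivAt_tiltedNumerator`** (`HasFDerivAt G (∫e^{−V}•(D₂ − D⊗D)dμ) ψ₀`),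
  **`hasFDerivAt_fderiv_neg_log_step`** (at EVERY `ψ₀`: `HasFDerivAt (ψ ↦ fderiv ℝ (−log Z) ψ) (Z⁻¹•∫e^{−V}•(D₂ − D⊗D)dμ + (Z⁻²•G)⊗G) ψ₀`);
  §4 toy.

HONEST (what this is NOT).  Differentiability and the closed form only: no size bound on the Hessian here (the letters (316)∕(318) bound
its diagonal and the covariance formula is read off in the successor file; the `O(ε)` covariance bound needs the expansion (312)); no
third-order remainder; scalar skeleton ((A3), NC-NE7b-α UNRULED); nothing of Bałaban's asserted.  BY-NAME EFFECT ON THE WALL: NONE.  NE7b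
NOT PRINTED ∕ NOT PROVED; spine PROVED 0∕9; rung (B)+1 — the programme's measures remain FINITE-torus statements; NOT the mass gap, NOT Clay.
HONEST DEPENDENCY: continuum YM on T⁴ ⇐ BetaPertH ∧ nine spine estimates (0∕9 proved); BetaPertH ⇐ (D1) ∧ (D4) ∧ CAP+tail; G-an2-4
gates asym, D1 and NE2∕3∕4.
-/

set_option autoImplicit false
set_option maxSynthPendingDepth 2

noncomputable section

namespace Summit.QuantumFields.BalabanUV.T4Continuum.NE7b.SupEffectiveActionHessian

open MeasureTheory ProbabilityTheory Finset Real Metric Filter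
open scoped BigOperators Topology
open SupEffectiveActionDerivative (hasFDerivAt_cellSum norm_cellDeriv_le sum_sq_ball_le aestronglyMeasurable_cellDeriv cellDeriv_apply
  integrable_domination hasFDerivAt_step hasFDerivAt_neg_log_step integrable_weighted_cellDeriv mul_opBound_le_of_le)
open SupSmallFieldGasReal (measurable_cellSum cellSum_eq_sum_biUnion)
open SupFluctuationAPriori (neg_sum_le_of_stable integrable_exp_neg)

variable {ι : Type} [Fintype ι] [DecidableEq ι] {V : Type*}

/-! ## §1. Calculus and size of the second base derivative -/

omit [DecidableEq ι] in
/-- **THE BASE DERIVATIVE IS DIFFERENTIABLE**: `ψ ↦ D(ψ,ω) = Σ_{p∈C}Σ_{x∈cell p}w'_x(ω_x+ψ_x)•proj_x` has Fréchet derivative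
`D₂(ψ,ω) = Σ_{p∈C}Σ_{x∈cell p}(w''_x(ω_x+ψ_x)•proj_x)⊗proj_x` at every `ψ` (`w'_x` with derivative `w''_x`). [folklore] -/
theorem hasFDerivAt_cellDeriv (cell : V → Finset ι) {w' w'' : ι → ℝ → ℝ} (hw'' : ∀ x t, HasDerivAt (w' x) (w'' x t) t) (C : Finset V)
    (ω ψ : EuclideanSpace ℝ ι) :
    HasFDerivAt (fun ψ' : EuclideanSpace ℝ ι =>
        ∑ p ∈ C, ∑ x ∈ cell p, (w' x (ω x + ψ' x)) • (EuclideanSpace.proj x : EuclideanSpace ℝ ι →L[ℝ] ℝ))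
      (∑ p ∈ C, ∑ x ∈ cell p, (w'' x (ω x + ψ x)) • ((EuclideanSpace.proj x : EuclideanSpace ℝ ι →L[ℝ] ℝ).smulRight
        (EuclideanSpace.proj x : EuclideanSpace ℝ ι →L[ℝ] ℝ))) ψ := by
  refine HasFDerivAt.fun_sum fun p _ => HasFDerivAt.fun_sum fun x _ => ?_
  have hlin : HasFDerivAt (fun ψ' : EuclideanSpace ℝ ι => ω x + ψ' x) (EuclideanSpace.proj x : EuclideanSpace ℝ ι →L[ℝ] ℝ) ψ :=
    ((EuclideanSpace.proj x : EuclideanSpace ℝ ι →L[ℝ] ℝ).hasFDerivAt).const_add (ω x)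
  have hc : HasFDerivAt (fun ψ' : EuclideanSpace ℝ ι => w' x (ω x + ψ' x))
      ((w'' x (ω x + ψ x)) • (EuclideanSpace.proj x : EuclideanSpace ℝ ι →L[ℝ] ℝ)) ψ :=
    (hw'' x (ω x + ψ x)).comp_hasFDerivAt ψ hlin
  refine (hc.smul_const (EuclideanSpace.proj x : EuclideanSpace ℝ ι →L[ℝ] ℝ)).congr_fderiv ?_
  ext h k
  simp only [ContinuousLinearMap.smulRight_apply, _root_.smul_apply, smul_eq_mul, PiLp.proj_apply]
  ring

omit [Fintype ι] [DecidableEq ι] in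
/-- The second base derivative applied to two directions: `D₂(ψ,ω)hk = Σ_{p∈C}Σ_{x∈cell p}w''_x(ω_x+ψ_x)h_xk_x`. [folklore] -/
theorem cellHess_apply (cell : V → Finset ι) (w'' : ι → ℝ → ℝ) (C : Finset V) (ω ψ h k : EuclideanSpace ℝ ι) :
    (∑ p ∈ C, ∑ x ∈ cell p, (w'' x (ω x + ψ x)) • ((EuclideanSpace.proj x : EuclideanSpace ℝ ι →L[ℝ] ℝ).smulRight
        (EuclideanSpace.proj x : EuclideanSpace ℝ ι →L[ℝ] ℝ))) h k =
      ∑ p ∈ C, ∑ x ∈ cell p, w'' x (ω x + ψ x) * h x * k x := by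
  simp only [_root_.sum_apply, ContinuousLinearMap.smulRight_apply, _root_.smul_apply, PiLp.proj_apply, smul_eq_mul, mul_assoc]

omit [Fintype ι] [DecidableEq ι] in
/-- The tensor square of the base derivative applied to two directions: `(D⊗D)hk = (Dh)(Dk) = (Σw'h)(Σw'k)`. [folklore] -/
theorem smulRight_cellDeriv_apply (cell : V → Finset ι) (w' : ι → ℝ → ℝ) (C : Finset V) (ω ψ h k : EuclideanSpace ℝ ι) :
    ((∑ p ∈ C, ∑ x ∈ cell p, (w' x (ω x + ψ x)) • (EuclideanSpace.proj x : EuclideanSpace ℝ ι →L[ℝ] ℝ)).smulRight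
        (∑ p ∈ C, ∑ x ∈ cell p, (w' x (ω x + ψ x)) • (EuclideanSpace.proj x : EuclideanSpace ℝ ι →L[ℝ] ℝ))) h k =
      (∑ p ∈ C, ∑ x ∈ cell p, w' x (ω x + ψ x) * h x) * (∑ p ∈ C, ∑ x ∈ cell p, w' x (ω x + ψ x) * k x) := by
  rw [ContinuousLinearMap.smulRight_apply, _root_.smul_apply, smul_eq_mul, cellDeriv_apply, cellDeriv_apply]

/-- **SIZE OF THE SECOND BASE DERIVATIVE**: `|w''_x(t)| ≤ κ₂`, pairwise disjoint cells ⟹ `‖D₂(ψ,ω)‖ ≤ κ₂·#Y`, `Y = ⋃_{p∈C}cell p`.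
[folklore] -/
theorem norm_cellHess_le (cell : V → Finset ι) (hdisj : ∀ p q, p ≠ q → Disjoint (cell p) (cell q)) {w'' : ι → ℝ → ℝ} {κ₂ : ℝ}
    (hw''b : ∀ x t, |w'' x t| ≤ κ₂) (C : Finset V) (ω ψ : EuclideanSpace ℝ ι) :
    ‖∑ p ∈ C, ∑ x ∈ cell p, (w'' x (ω x + ψ x)) • ((EuclideanSpace.proj x : EuclideanSpace ℝ ι →L[ℝ] ℝ).smulRight
        (EuclideanSpace.proj x : EuclideanSpace ℝ ι →L[ℝ] ℝ))‖ ≤ κ₂ * (C.biUnion cell).card := by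
  -- the coordinate projections have operator norm `≤ 1` and `‖a⊗b‖ = ‖a‖‖b‖`
  have hproj : ∀ x, ‖(EuclideanSpace.proj x : EuclideanSpace ℝ ι →L[ℝ] ℝ)‖ ≤ 1 := fun x =>
    ContinuousLinearMap.opNorm_le_bound _ zero_le_one fun v => by
      rw [one_mul]
      exact PiLp.norm_apply_le v x
  have hterm : ∀ x, ‖(w'' x (ω x + ψ x)) • ((EuclideanSpace.proj x : EuclideanSpace ℝ ι →L[ℝ] ℝ).smulRight
      (EuclideanSpace.proj x : EuclideanSpace ℝ ι →L[ℝ] ℝ))‖ ≤ κ₂ := by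
    intro x
    have h0 : 0 ≤ κ₂ := (abs_nonneg _).trans (hw''b x 0)
    rw [norm_smul, Real.norm_eq_abs, ContinuousLinearMap.norm_smulRight_apply]
    calc |w'' x (ω x + ψ x)| * (‖(EuclideanSpace.proj x : EuclideanSpace ℝ ι →L[ℝ] ℝ)‖ *
          ‖(EuclideanSpace.proj x : EuclideanSpace ℝ ι →L[ℝ] ℝ)‖) ≤ κ₂ * (1 * 1) :=
          mul_le_mul (hw''b x _) (mul_le_mul (hproj x) (hproj x) (norm_nonneg _) zero_le_one)
            (mul_nonneg (norm_nonneg _) (norm_nonneg _)) h0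
      _ = κ₂ := by ring
  calc ‖∑ p ∈ C, ∑ x ∈ cell p, (w'' x (ω x + ψ x)) • ((EuclideanSpace.proj x : EuclideanSpace ℝ ι →L[ℝ] ℝ).smulRight
          (EuclideanSpace.proj x : EuclideanSpace ℝ ι →L[ℝ] ℝ))‖
      ≤ ∑ p ∈ C, ‖∑ x ∈ cell p, (w'' x (ω x + ψ x)) • ((EuclideanSpace.proj x : EuclideanSpace ℝ ι →L[ℝ] ℝ).smulRight
          (EuclideanSpace.proj x : EuclideanSpace ℝ ι →L[ℝ] ℝ))‖ := norm_sum_le _ _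
    _ ≤ ∑ p ∈ C, ∑ x ∈ cell p, κ₂ := sum_le_sum fun p _ => (norm_sum_le _ _).trans (sum_le_sum fun x _ => hterm x)
    _ = κ₂ * (C.biUnion cell).card := by
        rw [cellSum_eq_sum_biUnion cell hdisj C (fun _ => κ₂), sum_const, nsmul_eq_mul, mul_comm]

omit [Fintype ι] [DecidableEq ι] in
/-- The second base derivative at `ψ` is an a.e.-strongly measurable function of `ω` (measurable `w''_x`). [folklore] -/
theorem aestronglyMeasurable_cellHess (μ : Measure (EuclideanSpace ℝ ι)) (cell : V → Finset ι) {w'' : ι → ℝ → ℝ}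
    (hw''m : ∀ x, Measurable (w'' x)) (C : Finset V) (ψ : EuclideanSpace ℝ ι) :
    AEStronglyMeasurable (fun ω : EuclideanSpace ℝ ι =>
      ∑ p ∈ C, ∑ x ∈ cell p, (w'' x (ω x + ψ x)) • ((EuclideanSpace.proj x : EuclideanSpace ℝ ι →L[ℝ] ℝ).smulRight
        (EuclideanSpace.proj x : EuclideanSpace ℝ ι →L[ℝ] ℝ))) μ := by
  refine Finset.aestronglyMeasurable_fun_sum C fun p _ => Finset.aestronglyMeasurable_fun_sum (cell p) fun x _ => ?_
  have hc : Measurable fun ω : EuclideanSpace ℝ ι => w'' x (ω x + ψ x) :=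
    (hw''m x).comp ((by fun_prop : Measurable fun ω : EuclideanSpace ℝ ι => ω x).add_const (ψ x))
  exact hc.aestronglyMeasurable.smul aestronglyMeasurable_const

omit [DecidableEq ι] in
/-- **THE PRODUCT RULE FOR THE WEIGHTED DERIVATIVE**: `w_x ∈ C²` ⟹ at every `ψ, ω`,
`d_ψ(e^{−V(ψ,ω)}•D(ψ,ω)) = e^{−V(ψ,ω)}•(D₂(ψ,ω) − D(ψ,ω)⊗D(ψ,ω))`. [folklore] -/
theorem hasFDerivAt_weightedCellDeriv (cell : V → Finset ι) {w w' w'' : ι → ℝ → ℝ} (hw' : ∀ x t, HasDerivAt (w x) (w' x t) t)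
    (hw'' : ∀ x t, HasDerivAt (w' x) (w'' x t) t) (C : Finset V) (ω ψ : EuclideanSpace ℝ ι) :
    HasFDerivAt (fun ψ' : EuclideanSpace ℝ ι => exp (-(∑ p ∈ C, ∑ x ∈ cell p, w x (ω x + ψ' x))) •
        (∑ p ∈ C, ∑ x ∈ cell p, (w' x (ω x + ψ' x)) • (EuclideanSpace.proj x : EuclideanSpace ℝ ι →L[ℝ] ℝ)))
      (exp (-(∑ p ∈ C, ∑ x ∈ cell p, w x (ω x + ψ x))) •
        ((∑ p ∈ C, ∑ x ∈ cell p, (w'' x (ω x + ψ x)) • ((EuclideanSpace.proj x : EuclideanSpace ℝ ι →L[ℝ] ℝ).smulRight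
            (EuclideanSpace.proj x : EuclideanSpace ℝ ι →L[ℝ] ℝ))) -
          (∑ p ∈ C, ∑ x ∈ cell p, (w' x (ω x + ψ x)) • (EuclideanSpace.proj x : EuclideanSpace ℝ ι →L[ℝ] ℝ)).smulRight
            (∑ p ∈ C, ∑ x ∈ cell p, (w' x (ω x + ψ x)) • (EuclideanSpace.proj x : EuclideanSpace ℝ ι →L[ℝ] ℝ)))) ψ := by
  have hE := ((hasFDerivAt_cellSum cell hw' C ω ψ).fun_neg).exp
  have hD := hasFDerivAt_cellDeriv cell hw'' C ω ψ
  refine (hE.smul hD).congr_fderiv ?_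
  ext h k
  simp only [_root_.add_apply, _root_.sub_apply, ContinuousLinearMap.smulRight_apply, _root_.smul_apply, _root_.neg_apply,
    smul_eq_mul]
  ring

/-- **Squares under one exponential**: `0 < δ`, `0 ≤ S ⟹ 8S² ≤ 4(δ²)⁻¹e^{2δS}` (`½t² ≤ eᵗ` at `t = 2δS`). [folklore] -/
theorem eight_sq_le {δ S : ℝ} (hδ : 0 < δ) (hS : 0 ≤ S) : 8 * S ^ 2 ≤ 4 * (δ ^ 2)⁻¹ * exp (2 * δ * S) := by
  have h := Real.quadratic_le_exp_of_nonneg (by positivity : 0 ≤ 2 * δ * S)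
  have h1 : 0 ≤ 2 * δ * S := by positivity
  have h2 : δ ^ 2 * (8 * S ^ 2) ≤ 4 * exp (2 * δ * S) := by nlinarith
  rw [mul_comm 4, mul_assoc, le_inv_mul_iff₀ (by positivity)]
  exact h2

/-! ## §2. The second domination on the unit ball about `ψ₀` -/

/-- **THE SECOND DOMINATION**: stability (`κ₀ ≥ 0`), `|w'_x(t)| ≤ κ₁|t|` (`κ₁ ≥ 0`), `|w''_x(t)| ≤ κ₂`, `0 < τ`, `0 < δ`; for `‖ψ − ψ₀‖ ≤ 1`
and every `ω`, with `Y = ⋃_{p∈C}cell p`, `M = 2Σ_{x∈Y}ψ₀,x² + 2`: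
`‖e^{−V(ψ,ω)}•(D₂(ψ,ω) − D(ψ,ω)⊗D(ψ,ω))‖ ≤ e^{κ₀(1+τ⁻¹)M}(κ₂#Y + κ₁²(2(#Y + 2M)² + 4(δ²)⁻¹))·e^{½(2κ₀(1+τ)+4δ)Σ_{x∈Y}ω_x²}`. [folklore] -/
theorem second_domination (cell : V → Finset ι) (hdisj : ∀ p q, p ≠ q → Disjoint (cell p) (cell q)) {w w' w'' : ι → ℝ → ℝ}
    {κ₀ κ₁ κ₂ τ δ : ℝ} (hκ₀ : 0 ≤ κ₀) (hκ₁ : 0 ≤ κ₁) (hτ : 0 < τ) (hδ : 0 < δ) (hstab : ∀ x, ∀ t : ℝ, -(κ₀ * t ^ 2) ≤ w x t)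
    (hw'b : ∀ x t, |w' x t| ≤ κ₁ * |t|) (hw''b : ∀ x t, |w'' x t| ≤ κ₂) (C : Finset V) (ψ₀ ψ : EuclideanSpace ℝ ι) (hψ : ‖ψ - ψ₀‖ ≤ 1)
    (ω : EuclideanSpace ℝ ι) :
    ‖exp (-(∑ p ∈ C, ∑ x ∈ cell p, w x (ω x + ψ x))) •
        ((∑ p ∈ C, ∑ x ∈ cell p, (w'' x (ω x + ψ x)) • ((EuclideanSpace.proj x : EuclideanSpace ℝ ι →L[ℝ] ℝ).smulRight
            (EuclideanSpace.proj x : EuclideanSpace ℝ ι →L[ℝ] ℝ))) -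
          (∑ p ∈ C, ∑ x ∈ cell p, (w' x (ω x + ψ x)) • (EuclideanSpace.proj x : EuclideanSpace ℝ ι →L[ℝ] ℝ)).smulRight
            (∑ p ∈ C, ∑ x ∈ cell p, (w' x (ω x + ψ x)) • (EuclideanSpace.proj x : EuclideanSpace ℝ ι →L[ℝ] ℝ)))‖ ≤
      exp (κ₀ * (1 + τ⁻¹) * (2 * ∑ x ∈ C.biUnion cell, ψ₀ x ^ 2 + 2)) *
        (κ₂ * (C.biUnion cell).card + κ₁ ^ 2 * (2 * ((C.biUnion cell).card + 2 * (2 * ∑ x ∈ C.biUnion cell, ψ₀ x ^ 2 + 2)) ^ 2 +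
          4 * (δ ^ 2)⁻¹)) *
        exp ((2 * κ₀ * (1 + τ) + 4 * δ) * (∑ x ∈ C.biUnion cell, ω x ^ 2) / 2) := by
  set Y := C.biUnion cell with hY
  set M : ℝ := 2 * ∑ x ∈ Y, ψ₀ x ^ 2 + 2 with hM
  set Sω : ℝ := ∑ x ∈ Y, ω x ^ 2 with hSω
  have hSω0 : 0 ≤ Sω := sum_nonneg fun x _ => sq_nonneg _
  have hM0 : 0 ≤ M := by rw [hM]; positivity
  have hψM : ∑ x ∈ Y, ψ x ^ 2 ≤ M := sum_sq_ball_le Y hψ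
  -- the exponent: stability + Young
  have hV : -(∑ p ∈ C, ∑ x ∈ cell p, w x (ω x + ψ x)) ≤ κ₀ * (1 + τ) * Sω + κ₀ * (1 + τ⁻¹) * M := by
    rw [cellSum_eq_sum_biUnion cell hdisj C]
    have h := neg_sum_le_of_stable Y w hκ₀ hτ hstab (fun x => ω x) (fun x => ψ x)
    have h2 : κ₀ * (1 + τ⁻¹) * ∑ x ∈ Y, ψ x ^ 2 ≤ κ₀ * (1 + τ⁻¹) * M := mul_le_mul_of_nonneg_left hψM (by positivity)
    linarith
  -- the first derivative, squared
  have hD : ‖∑ p ∈ C, ∑ x ∈ cell p, (w' x (ω x + ψ x)) • (EuclideanSpace.proj x : EuclideanSpace ℝ ι →L[ℝ] ℝ)‖ ≤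
      κ₁ * ((Y.card : ℝ) + 2 * M + 2 * Sω) := by
    refine (norm_cellDeriv_le cell hdisj hκ₁ hw'b C ω ψ).trans (mul_le_mul_of_nonneg_left ?_ hκ₁)
    linarith
  have hD0 : 0 ≤ κ₁ * ((Y.card : ℝ) + 2 * M + 2 * Sω) := by positivity
  have hDD : ‖(∑ p ∈ C, ∑ x ∈ cell p, (w' x (ω x + ψ x)) • (EuclideanSpace.proj x : EuclideanSpace ℝ ι →L[ℝ] ℝ)).smulRight
      (∑ p ∈ C, ∑ x ∈ cell p, (w' x (ω x + ψ x)) • (EuclideanSpace.proj x : EuclideanSpace ℝ ι →L[ℝ] ℝ))‖ ≤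
      κ₁ ^ 2 * ((Y.card : ℝ) + 2 * M + 2 * Sω) ^ 2 := by
    rw [ContinuousLinearMap.norm_smulRight_apply]
    calc _ ≤ κ₁ * ((Y.card : ℝ) + 2 * M + 2 * Sω) * (κ₁ * ((Y.card : ℝ) + 2 * M + 2 * Sω)) :=
          mul_le_mul hD hD (norm_nonneg _) hD0
      _ = κ₁ ^ 2 * ((Y.card : ℝ) + 2 * M + 2 * Sω) ^ 2 := by ring
  -- the second derivative
  have hD₂ := norm_cellHess_le cell hdisj hw''b C ω ψ
  -- polynomial prefactors under one exponential `e^{2δΣω²}`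
  have h1 : 1 ≤ exp (2 * δ * Sω) := one_le_exp (by positivity)
  have h8 := eight_sq_le hδ hSω0
  have hκ₂ : 0 ≤ κ₂ * (Y.card : ℝ) := by
    rcases Y.eq_empty_or_nonempty with h | ⟨x, _⟩
    · rw [h, card_empty, Nat.cast_zero, mul_zero]
    · exact mul_nonneg ((abs_nonneg _).trans (hw''b x 0)) (Nat.cast_nonneg _)
  have hpoly : κ₂ * (Y.card : ℝ) + κ₁ ^ 2 * ((Y.card : ℝ) + 2 * M + 2 * Sω) ^ 2 ≤
      (κ₂ * (Y.card : ℝ) + κ₁ ^ 2 * (2 * ((Y.card : ℝ) + 2 * M) ^ 2 + 4 * (δ ^ 2)⁻¹)) * exp (2 * δ * Sω) := by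
    have hsq : ((Y.card : ℝ) + 2 * M + 2 * Sω) ^ 2 ≤ 2 * ((Y.card : ℝ) + 2 * M) ^ 2 + 8 * Sω ^ 2 := by
      nlinarith [sq_nonneg ((Y.card : ℝ) + 2 * M - 2 * Sω)]
    have hsq' : ((Y.card : ℝ) + 2 * M + 2 * Sω) ^ 2 ≤ (2 * ((Y.card : ℝ) + 2 * M) ^ 2 + 4 * (δ ^ 2)⁻¹) * exp (2 * δ * Sω) := by
      have ha : 2 * ((Y.card : ℝ) + 2 * M) ^ 2 ≤ 2 * ((Y.card : ℝ) + 2 * M) ^ 2 * exp (2 * δ * Sω) :=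
        le_mul_of_one_le_right (by positivity) h1
      nlinarith
    have hb : κ₂ * (Y.card : ℝ) ≤ κ₂ * (Y.card : ℝ) * exp (2 * δ * Sω) := le_mul_of_one_le_right hκ₂ h1
    have hc : κ₁ ^ 2 * ((Y.card : ℝ) + 2 * M + 2 * Sω) ^ 2 ≤
        κ₁ ^ 2 * ((2 * ((Y.card : ℝ) + 2 * M) ^ 2 + 4 * (δ ^ 2)⁻¹) * exp (2 * δ * Sω)) :=
      mul_le_mul_of_nonneg_left hsq' (sq_nonneg _)
    nlinarith
  -- assemble
  rw [norm_smul, Real.norm_eq_abs, abs_of_pos (exp_pos _)]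
  have hK0 : 0 ≤ κ₂ * (Y.card : ℝ) + κ₁ ^ 2 * (2 * ((Y.card : ℝ) + 2 * M) ^ 2 + 4 * (δ ^ 2)⁻¹) := by positivity
  calc exp (-(∑ p ∈ C, ∑ x ∈ cell p, w x (ω x + ψ x))) *
        ‖(∑ p ∈ C, ∑ x ∈ cell p, (w'' x (ω x + ψ x)) • ((EuclideanSpace.proj x : EuclideanSpace ℝ ι →L[ℝ] ℝ).smulRight
            (EuclideanSpace.proj x : EuclideanSpace ℝ ι →L[ℝ] ℝ))) -
          (∑ p ∈ C, ∑ x ∈ cell p, (w' x (ω x + ψ x)) • (EuclideanSpace.proj x : EuclideanSpace ℝ ι →L[ℝ] ℝ)).smulRight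
            (∑ p ∈ C, ∑ x ∈ cell p, (w' x (ω x + ψ x)) • (EuclideanSpace.proj x : EuclideanSpace ℝ ι →L[ℝ] ℝ))‖
      ≤ exp (κ₀ * (1 + τ) * Sω + κ₀ * (1 + τ⁻¹) * M) *
          ((κ₂ * (Y.card : ℝ) + κ₁ ^ 2 * (2 * ((Y.card : ℝ) + 2 * M) ^ 2 + 4 * (δ ^ 2)⁻¹)) * exp (2 * δ * Sω)) :=
        mul_le_mul (exp_le_exp.2 hV) (((norm_sub_le _ _).trans (add_le_add hD₂ hDD)).trans hpoly) (norm_nonneg _) (exp_pos _).le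
    _ = exp (κ₀ * (1 + τ⁻¹) * M) * (κ₂ * (Y.card : ℝ) + κ₁ ^ 2 * (2 * ((Y.card : ℝ) + 2 * M) ^ 2 + 4 * (δ ^ 2)⁻¹)) *
          exp ((2 * κ₀ * (1 + τ) + 4 * δ) * Sω / 2) := by
        have he : exp (κ₀ * (1 + τ) * Sω + κ₀ * (1 + τ⁻¹) * M) * exp (2 * δ * Sω) =
            exp (κ₀ * (1 + τ⁻¹) * M) * exp ((2 * κ₀ * (1 + τ) + 4 * δ) * Sω / 2) := by
          rw [← exp_add, ← exp_add]
          congr 1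
          ring
        calc exp (κ₀ * (1 + τ) * Sω + κ₀ * (1 + τ⁻¹) * M) *
              ((κ₂ * (Y.card : ℝ) + κ₁ ^ 2 * (2 * ((Y.card : ℝ) + 2 * M) ^ 2 + 4 * (δ ^ 2)⁻¹)) * exp (2 * δ * Sω))
            = (κ₂ * (Y.card : ℝ) + κ₁ ^ 2 * (2 * ((Y.card : ℝ) + 2 * M) ^ 2 + 4 * (δ ^ 2)⁻¹)) *
                (exp (κ₀ * (1 + τ) * Sω + κ₀ * (1 + τ⁻¹) * M) * exp (2 * δ * Sω)) := by ring
          _ = _ := by rw [he]; ring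

/-! ## §3. THE END: the effective action is twice differentiable at every external field -/

section TheEnd

variable {Γ : Matrix ι ι ℝ} {γop : ℝ} {cell : V → Finset ι} {w w' w'' : ι → ℝ → ℝ} {κ₀ κ₁ κ₂ τ δ θ : ℝ}

/-- **THE TILTED NUMERATOR IS DIFFERENTIABLE**: `Γ ⪰ 0`, `Γ ⪯ γ_op·1`; pairwise disjoint cells; `w_x ∈ C²` with measurable `w'_x, w''_x`,
`|w'_x(t)| ≤ κ₁|t|` (`κ₁ ≥ 0`), `|w''_x(t)| ≤ κ₂`, `−κ₀t² ≤ w_x(t)` (`κ₀ ≥ 0`); `0 < τ`, `0 < δ`, `θ < 1`, `(2κ₀(1+τ)+4δ)γ_op ≤ θ` ⟹ at EVERY `ψ₀`,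
`HasFDerivAt (ψ ↦ ∫e^{−V(ψ,ω)}•D(ψ,ω)dN(0,Γ)) (∫e^{−V(ψ₀,ω)}•(D₂(ψ₀,ω) − D(ψ₀,ω)⊗D(ψ₀,ω))dN(0,Γ)) ψ₀`. [folklore] -/
theorem hasFDerivAt_tiltedNumerator (hΓ : Γ.PosSemidef) (hΓop : (γop • (1 : Matrix ι ι ℝ) - Γ).PosSemidef)
    (hdisj : ∀ p q, p ≠ q → Disjoint (cell p) (cell q)) (hw' : ∀ x t, HasDerivAt (w x) (w' x t) t)
    (hw'' : ∀ x t, HasDerivAt (w' x) (w'' x t) t) (hw'm : ∀ x, Measurable (w' x)) (hw''m : ∀ x, Measurable (w'' x))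
    (hκ₀ : 0 ≤ κ₀) (hκ₁ : 0 ≤ κ₁) (hτ : 0 < τ) (hδ : 0 < δ) (hθ1 : θ < 1) (hκθ : (2 * κ₀ * (1 + τ) + 4 * δ) * γop ≤ θ)
    (hstab : ∀ x, ∀ t : ℝ, -(κ₀ * t ^ 2) ≤ w x t) (hw'b : ∀ x t, |w' x t| ≤ κ₁ * |t|) (hw''b : ∀ x t, |w'' x t| ≤ κ₂)
    (C : Finset V) (ψ₀ : EuclideanSpace ℝ ι) :
    HasFDerivAt (fun ψ : EuclideanSpace ℝ ι =>
        ∫ ω : EuclideanSpace ℝ ι, exp (-(∑ p ∈ C, ∑ x ∈ cell p, w x (ω x + ψ x))) •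
          (∑ p ∈ C, ∑ x ∈ cell p, (w' x (ω x + ψ x)) • (EuclideanSpace.proj x : EuclideanSpace ℝ ι →L[ℝ] ℝ))
          ∂(multivariateGaussian 0 Γ))
      (∫ ω : EuclideanSpace ℝ ι, exp (-(∑ p ∈ C, ∑ x ∈ cell p, w x (ω x + ψ₀ x))) •
        ((∑ p ∈ C, ∑ x ∈ cell p, (w'' x (ω x + ψ₀ x)) • ((EuclideanSpace.proj x : EuclideanSpace ℝ ι →L[ℝ] ℝ).smulRight
            (EuclideanSpace.proj x : EuclideanSpace ℝ ι →L[ℝ] ℝ))) -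
          (∑ p ∈ C, ∑ x ∈ cell p, (w' x (ω x + ψ₀ x)) • (EuclideanSpace.proj x : EuclideanSpace ℝ ι →L[ℝ] ℝ)).smulRight
            (∑ p ∈ C, ∑ x ∈ cell p, (w' x (ω x + ψ₀ x)) • (EuclideanSpace.proj x : EuclideanSpace ℝ ι →L[ℝ] ℝ)))
        ∂(multivariateGaussian 0 Γ)) ψ₀ := by
  have hw : ∀ x, Measurable (w x) := fun x => (continuous_iff_continuousAt.2 fun t => (hw' x t).continuousAt).measurable
  -- measurability of the integrand at every `ψ` and of the derivative at `ψ₀`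
  have hFm : ∀ ψ : EuclideanSpace ℝ ι, AEStronglyMeasurable (fun ω : EuclideanSpace ℝ ι =>
      exp (-(∑ p ∈ C, ∑ x ∈ cell p, w x (ω x + ψ x))) •
        (∑ p ∈ C, ∑ x ∈ cell p, (w' x (ω x + ψ x)) • (EuclideanSpace.proj x : EuclideanSpace ℝ ι →L[ℝ] ℝ)))
      (multivariateGaussian 0 Γ) := fun ψ =>
    (continuous_exp.comp_aestronglyMeasurable (measurable_cellSum cell w hw C (fun x => ψ x)).aestronglyMeasurable.neg).smul
      (aestronglyMeasurable_cellDeriv _ cell hw'm C ψ)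
  have hDm := aestronglyMeasurable_cellDeriv (multivariateGaussian 0 Γ) cell hw'm C ψ₀
  have hF'm : AEStronglyMeasurable (fun ω : EuclideanSpace ℝ ι => exp (-(∑ p ∈ C, ∑ x ∈ cell p, w x (ω x + ψ₀ x))) •
      ((∑ p ∈ C, ∑ x ∈ cell p, (w'' x (ω x + ψ₀ x)) • ((EuclideanSpace.proj x : EuclideanSpace ℝ ι →L[ℝ] ℝ).smulRight
          (EuclideanSpace.proj x : EuclideanSpace ℝ ι →L[ℝ] ℝ))) -
        (∑ p ∈ C, ∑ x ∈ cell p, (w' x (ω x + ψ₀ x)) • (EuclideanSpace.proj x : EuclideanSpace ℝ ι →L[ℝ] ℝ)).smulRight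
          (∑ p ∈ C, ∑ x ∈ cell p, (w' x (ω x + ψ₀ x)) • (EuclideanSpace.proj x : EuclideanSpace ℝ ι →L[ℝ] ℝ))))
      (multivariateGaussian 0 Γ) :=
    (continuous_exp.comp_aestronglyMeasurable (measurable_cellSum cell w hw C (fun x => ψ₀ x)).aestronglyMeasurable.neg).smul
      ((aestronglyMeasurable_cellHess _ cell hw''m C ψ₀).sub
        (isBoundedBilinearMap_smulRight.continuous.comp_aestronglyMeasurable (hDm.prodMk hDm)))
  exact hasFDerivAt_integral_of_dominated_of_fderiv_le (μ := multivariateGaussian 0 Γ) (x₀ := ψ₀) (s := closedBall ψ₀ 1)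
    (closedBall_mem_nhds ψ₀ one_pos) (Eventually.of_forall hFm)
    (integrable_weighted_cellDeriv hΓ hΓop hdisj hw' hw'm hκ₀ hκ₁ hτ hδ hθ1 hκθ hstab hw'b C ψ₀) hF'm
    (Eventually.of_forall fun ω ψ hψ => by
      rw [mem_closedBall, dist_eq_norm] at hψ
      exact second_domination cell hdisj hκ₀ hκ₁ hτ hδ hstab hw'b hw''b C ψ₀ ψ hψ ω)
    (integrable_domination hΓ hΓop (C.biUnion cell) hκ₀ hτ hδ hθ1 hκθ
      (exp (κ₀ * (1 + τ⁻¹) * (2 * ∑ x ∈ C.biUnion cell, ψ₀ x ^ 2 + 2)) *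
        (κ₂ * (C.biUnion cell).card + κ₁ ^ 2 * (2 * ((C.biUnion cell).card + 2 * (2 * ∑ x ∈ C.biUnion cell, ψ₀ x ^ 2 + 2)) ^ 2 +
          4 * (δ ^ 2)⁻¹))))
    (Eventually.of_forall fun ω ψ _ => hasFDerivAt_weightedCellDeriv cell hw' hw'' C ω ψ)

/-- **THE END — THE EFFECTIVE ACTION OF THE STEP IS TWICE DIFFERENTIABLE AT EVERY EXTERNAL FIELD.**  Under the hypotheses of
`hasFDerivAt_tiltedNumerator` and `0 < θ`, at EVERY `ψ₀`, with `Z = Z(ψ₀)`, `G = ∫e^{−V(ψ₀,ω)}•D(ψ₀,ω)dμ`: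
`HasFDerivAt (ψ ↦ fderiv ℝ (−log Z) ψ) (Z⁻¹ • ∫e^{−V(ψ₀,ω)}•(D₂(ψ₀,ω) − D(ψ₀,ω)⊗D(ψ₀,ω))dμ + ((Z²)⁻¹•G)⊗G) ψ₀` — the gradient map of the
next potential is differentiable, and its derivative (the Hessian) is the quotient-rule combination of the two tilted integrals. [folklore] -/
theorem hasFDerivAt_fderiv_neg_log_step (hΓ : Γ.PosSemidef) (hΓop : (γop • (1 : Matrix ι ι ℝ) - Γ).PosSemidef)
    (hdisj : ∀ p q, p ≠ q → Disjoint (cell p) (cell q)) (hw' : ∀ x t, HasDerivAt (w x) (w' x t) t)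
    (hw'' : ∀ x t, HasDerivAt (w' x) (w'' x t) t) (hw'm : ∀ x, Measurable (w' x)) (hw''m : ∀ x, Measurable (w'' x))
    (hκ₀ : 0 ≤ κ₀) (hκ₁ : 0 ≤ κ₁) (hτ : 0 < τ) (hδ : 0 < δ) (hθ0 : 0 < θ) (hθ1 : θ < 1) (hκθ : (2 * κ₀ * (1 + τ) + 4 * δ) * γop ≤ θ)
    (hstab : ∀ x, ∀ t : ℝ, -(κ₀ * t ^ 2) ≤ w x t) (hw'b : ∀ x t, |w' x t| ≤ κ₁ * |t|) (hw''b : ∀ x t, |w'' x t| ≤ κ₂)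
    (C : Finset V) (ψ₀ : EuclideanSpace ℝ ι) :
    HasFDerivAt (fun ψ : EuclideanSpace ℝ ι => fderiv ℝ (fun φ : EuclideanSpace ℝ ι =>
        -log (∫ ω : EuclideanSpace ℝ ι, exp (-(∑ p ∈ C, ∑ x ∈ cell p, w x (ω x + φ x))) ∂(multivariateGaussian 0 Γ))) ψ)
      ((∫ ω : EuclideanSpace ℝ ι, exp (-(∑ p ∈ C, ∑ x ∈ cell p, w x (ω x + ψ₀ x))) ∂(multivariateGaussian 0 Γ))⁻¹ •
          (∫ ω : EuclideanSpace ℝ ι, exp (-(∑ p ∈ C, ∑ x ∈ cell p, w x (ω x + ψ₀ x))) •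
            ((∑ p ∈ C, ∑ x ∈ cell p, (w'' x (ω x + ψ₀ x)) • ((EuclideanSpace.proj x : EuclideanSpace ℝ ι →L[ℝ] ℝ).smulRight
                (EuclideanSpace.proj x : EuclideanSpace ℝ ι →L[ℝ] ℝ))) -
              (∑ p ∈ C, ∑ x ∈ cell p, (w' x (ω x + ψ₀ x)) • (EuclideanSpace.proj x : EuclideanSpace ℝ ι →L[ℝ] ℝ)).smulRight
                (∑ p ∈ C, ∑ x ∈ cell p, (w' x (ω x + ψ₀ x)) • (EuclideanSpace.proj x : EuclideanSpace ℝ ι →L[ℝ] ℝ)))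
            ∂(multivariateGaussian 0 Γ)) +
        (((∫ ω : EuclideanSpace ℝ ι, exp (-(∑ p ∈ C, ∑ x ∈ cell p, w x (ω x + ψ₀ x))) ∂(multivariateGaussian 0 Γ)) ^ 2)⁻¹ •
          ∫ ω : EuclideanSpace ℝ ι, exp (-(∑ p ∈ C, ∑ x ∈ cell p, w x (ω x + ψ₀ x))) •
            (∑ p ∈ C, ∑ x ∈ cell p, (w' x (ω x + ψ₀ x)) • (EuclideanSpace.proj x : EuclideanSpace ℝ ι →L[ℝ] ℝ))
            ∂(multivariateGaussian 0 Γ)).smulRight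
          (∫ ω : EuclideanSpace ℝ ι, exp (-(∑ p ∈ C, ∑ x ∈ cell p, w x (ω x + ψ₀ x))) •
            (∑ p ∈ C, ∑ x ∈ cell p, (w' x (ω x + ψ₀ x)) • (EuclideanSpace.proj x : EuclideanSpace ℝ ι →L[ℝ] ℝ))
            ∂(multivariateGaussian 0 Γ))) ψ₀ := by
  have hw : ∀ x, Measurable (w x) := fun x => (continuous_iff_continuousAt.2 fun t => (hw' x t).continuousAt).measurable
  have hκθ₀ : 2 * κ₀ * (1 + τ) * γop ≤ θ := mul_opBound_le_of_le (by positivity) (by linarith) hθ0.le hκθ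
  -- the gradient map IS `ψ ↦ Z(ψ)⁻¹ • G(ψ)` (by (313) at every `ψ`)
  have hgrad : (fun ψ : EuclideanSpace ℝ ι => fderiv ℝ (fun φ : EuclideanSpace ℝ ι =>
      -log (∫ ω : EuclideanSpace ℝ ι, exp (-(∑ p ∈ C, ∑ x ∈ cell p, w x (ω x + φ x))) ∂(multivariateGaussian 0 Γ))) ψ) =
      fun ψ : EuclideanSpace ℝ ι =>
        (∫ ω : EuclideanSpace ℝ ι, exp (-(∑ p ∈ C, ∑ x ∈ cell p, w x (ω x + ψ x))) ∂(multivariateGaussian 0 Γ))⁻¹ •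
          ∫ ω : EuclideanSpace ℝ ι, exp (-(∑ p ∈ C, ∑ x ∈ cell p, w x (ω x + ψ x))) •
            (∑ p ∈ C, ∑ x ∈ cell p, (w' x (ω x + ψ x)) • (EuclideanSpace.proj x : EuclideanSpace ℝ ι →L[ℝ] ℝ))
            ∂(multivariateGaussian 0 Γ) :=
    funext fun ψ => (hasFDerivAt_neg_log_step hΓ hΓop hdisj hw' hw'm hκ₀ hκ₁ hτ hδ hθ0 hθ1 hκθ hstab hw'b C ψ).fderiv
  rw [hgrad]
  -- `Z > 0`, `d_ψZ = −G`, `d_ψ(Z⁻¹) = Z⁻²•G`, `d_ψG = ∫e^{−V}•(D₂ − D⊗D)`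
  have hI : Integrable (fun ω : EuclideanSpace ℝ ι => exp (-(∑ p ∈ C, ∑ x ∈ cell p, w x (ω x + ψ₀ x))))
      (multivariateGaussian 0 Γ) := by
    have h := integrable_exp_neg hΓ hΓop (C.biUnion cell) w hw hκ₀ hτ hθ1 hκθ₀ hstab (fun x => ψ₀ x)
    refine h.congr (ae_of_all _ fun ω => ?_)
    simp only
    rw [cellSum_eq_sum_biUnion cell hdisj C]
  have hZ : 0 < ∫ ω : EuclideanSpace ℝ ι, exp (-(∑ p ∈ C, ∑ x ∈ cell p, w x (ω x + ψ₀ x))) ∂(multivariateGaussian 0 Γ) :=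
    integral_exp_pos hI
  have hZd := hasFDerivAt_step hΓ hΓop hdisj hw' hw'm hκ₀ hκ₁ hτ hδ hθ0 hθ1 hκθ hstab hw'b C ψ₀
  have hZinv := (hasDerivAt_inv hZ.ne').comp_hasFDerivAt ψ₀ hZd
  have hG := hasFDerivAt_tiltedNumerator hΓ hΓop hdisj hw' hw'' hw'm hw''m hκ₀ hκ₁ hτ hδ hθ1 hκθ hstab hw'b hw''b C ψ₀
  refine (hZinv.smul hG).congr_fderiv ?_
  simp only [Function.comp_apply, smul_neg, neg_smul, neg_neg]

end TheEnd

/-! ## §4. Toy -/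

/-- Toy (§1): with `δ = 1` and `S = 1`, `8 ≤ 4e²`. -/
example : 8 * (1 : ℝ) ^ 2 ≤ 4 * ((1 : ℝ) ^ 2)⁻¹ * exp (2 * 1 * 1) := eight_sq_le one_pos zero_le_one

end Summit.QuantumFields.BalabanUV.T4Continuum.NE7b.SupEffectiveActionHessian
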